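import Summits.ValiantsHypothesis.ValiantsHypothesis.Theorems.DefinabilityGapAlienExclusion
import Mathlib.Analysis.MeanInequalities
import HarnessLib

/-!
# DefinabilityGap — pattern counts: permutations with prescribed values, shared rows, the per-block bound, AM–GM

Route `route-ValiantsHypothesis-DefinabilityGap` (decomp-valiant, lens 5), supporting `KIPlantedHitting`
(stmt-ValiantsHypothesis-23547). Source: decomp-valiant lens-5 g16, NOTE-g16 §3.4 (the counting ingredients of Lemma 3).
The elementary counts used by the first-moment argument of `DefinabilityGapRandomPatterns`:
`#{ρ : ρ a = x}·m = m!`, `#{ρ : ρ a₁ = x₁, ρ a₂ = x₂}·(m−1)·m = m!` (`card_filter_apply_mul`, `card_filter_apply₂_mul`);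
blocks `b ≠ d` share `≤ 2` positions, counted per column (`sum_rowShare_le_two`); for a host `d` and a column-to-block map `f`
the admissible patterns of a block serving `k` columns number `≤ m!·∏ r/(m−1)^k` (`card_admissible_mul_le`); and the integer
AM–GM `(∏ R_a)·m^m ≤ (Σ R_a)^m` (`prod_mul_pow_le_sum_pow`). 0 sorry; VP ≠ VNP untouched.
-/

set_option linter.dupNamespace false

noncomputable section

open MvPolynomial
open Literature.Computability.AlgebraicComplexity Literature.Computability.MetaComplexity
open Summit.ValiantsHypothesis.ValiantsHypothesis.Theorems.DefinabilityGapAffineRung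
open Summit.ValiantsHypothesis.ValiantsHypothesis.Theorems.DefinabilityGapAlienExclusion

namespace Summit.ValiantsHypothesis.ValiantsHypothesis.Theorems.DefinabilityGapPatternCounts

variable {m : ℕ}

/-! ## 1. Permutations with one or two prescribed values -/

section PermCount

open Equiv

/-- Fibres of `ρ ↦ ρ a` are no larger than each other. [folklore] -/
theorem card_filter_apply_le (a x x' : Fin m) :
    (Finset.univ.filter fun ρ : Perm (Fin m) => ρ a = x).card ≤
      (Finset.univ.filter fun ρ : Perm (Fin m) => ρ a = x').card := by
  classical
  refine Finset.card_le_card_of_injOn (fun ρ => swap x x' * ρ) ?_ ?_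
  · intro ρ hρ
    simp only [Finset.coe_filter, Finset.mem_univ, true_and, Set.mem_setOf_eq] at hρ ⊢
    rw [Perm.mul_apply, hρ, swap_apply_left]
  · intro ρ _ ρ' _ h
    exact mul_left_cancel h

/-- `#{ρ : ρ a = x} · m = m!`. [folklore] -/
theorem card_filter_apply_mul (a x : Fin m) :
    (Finset.univ.filter fun ρ : Perm (Fin m) => ρ a = x).card * m = Nat.factorial m := by
  classical
  have hsum := Finset.card_eq_sum_card_fiberwise (s := (Finset.univ : Finset (Perm (Fin m))))
    (t := (Finset.univ : Finset (Fin m))) (f := fun ρ : Perm (Fin m) => ρ a) (fun _ _ => Finset.mem_univ _)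
  have heq : ∀ x' ∈ (Finset.univ : Finset (Fin m)),
      (Finset.univ.filter fun ρ : Perm (Fin m) => ρ a = x').card =
        (Finset.univ.filter fun ρ : Perm (Fin m) => ρ a = x).card :=
    fun x' _ => le_antisymm (card_filter_apply_le a x' x) (card_filter_apply_le a x x')
  rw [Finset.sum_congr rfl heq, Finset.sum_const] at hsum
  simp only [Finset.card_univ, Fintype.card_fin, Fintype.card_perm, smul_eq_mul] at hsum
  rw [mul_comm]; exact hsum.symm

/-- Fibres of `ρ ↦ ρ a₂` inside `{ρ a₁ = x₁}` are no larger than each other. [folklore] -/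
theorem card_filter_apply₂_le {a₁ a₂ x₁ x₂ x₂' : Fin m} (h₂ : x₂ ≠ x₁) (h₂' : x₂' ≠ x₁) :
    (Finset.univ.filter fun ρ : Perm (Fin m) => ρ a₁ = x₁ ∧ ρ a₂ = x₂).card ≤
      (Finset.univ.filter fun ρ : Perm (Fin m) => ρ a₁ = x₁ ∧ ρ a₂ = x₂').card := by
  classical
  refine Finset.card_le_card_of_injOn (fun ρ => swap x₂ x₂' * ρ) ?_ ?_
  · intro ρ hρ
    simp only [Finset.coe_filter, Finset.mem_univ, true_and, Set.mem_setOf_eq] at hρ ⊢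
    rw [Perm.mul_apply, Perm.mul_apply, hρ.1, hρ.2, swap_apply_left, swap_apply_of_ne_of_ne h₂.symm h₂'.symm]
    exact ⟨rfl, rfl⟩
  · intro ρ _ ρ' _ h
    exact mul_left_cancel h

/-- `#{ρ : ρ a₁ = x₁, ρ a₂ = x₂} · (m − 1) = #{ρ : ρ a₁ = x₁}` for `a₁ ≠ a₂`, `x₂ ≠ x₁`. [folklore] -/
theorem card_filter_apply₂_mul {a₁ a₂ x₁ x₂ : Fin m} (ha : a₁ ≠ a₂) (hx : x₂ ≠ x₁) :
    (Finset.univ.filter fun ρ : Perm (Fin m) => ρ a₁ = x₁ ∧ ρ a₂ = x₂).card * (m - 1) =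
      (Finset.univ.filter fun ρ : Perm (Fin m) => ρ a₁ = x₁).card := by
  classical
  have hsum := Finset.card_eq_sum_card_fiberwise
    (s := (Finset.univ.filter fun ρ : Perm (Fin m) => ρ a₁ = x₁))
    (t := (Finset.univ : Finset (Fin m))) (f := fun ρ : Perm (Fin m) => ρ a₂) (fun _ _ => Finset.mem_univ _)
  have hfib : ∀ x', ((Finset.univ.filter fun ρ : Perm (Fin m) => ρ a₁ = x₁).filter fun ρ => ρ a₂ = x') =
      (Finset.univ.filter fun ρ : Perm (Fin m) => ρ a₁ = x₁ ∧ ρ a₂ = x') := by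
    intro x'; rw [Finset.filter_filter]
  simp_rw [hfib] at hsum
  rw [← Finset.sum_erase_add _ _ (Finset.mem_univ x₁)] at hsum
  have hzero : (Finset.univ.filter fun ρ : Perm (Fin m) => ρ a₁ = x₁ ∧ ρ a₂ = x₁).card = 0 := by
    rw [Finset.card_eq_zero, Finset.filter_eq_empty_iff]
    intro ρ _ h
    exact ha (ρ.injective (h.1.trans h.2.symm))
  have heq : ∀ x' ∈ (Finset.univ : Finset (Fin m)).erase x₁,
      (Finset.univ.filter fun ρ : Perm (Fin m) => ρ a₁ = x₁ ∧ ρ a₂ = x').card =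
        (Finset.univ.filter fun ρ : Perm (Fin m) => ρ a₁ = x₁ ∧ ρ a₂ = x₂).card := by
    intro x' hx'
    have h' : x' ≠ x₁ := (Finset.mem_erase.1 hx').1
    exact le_antisymm (card_filter_apply₂_le h' hx) (card_filter_apply₂_le hx h')
  rw [hzero, add_zero, Finset.sum_congr rfl heq, Finset.sum_const, Finset.card_erase_of_mem (Finset.mem_univ _),
    Finset.card_univ, Fintype.card_fin, smul_eq_mul] at hsum
  rw [mul_comm]; exact hsum.symm

/-- `#{ρ : ρ a = x} · (m − 1) ≤ m!`. [folklore] -/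
theorem card_filter_apply_mul_le (a x : Fin m) :
    (Finset.univ.filter fun ρ : Perm (Fin m) => ρ a = x).card * (m - 1) ≤ Nat.factorial m := by
  rw [← card_filter_apply_mul a x]
  exact Nat.mul_le_mul_left _ (Nat.sub_le m 1)

/-- `#{ρ : ρ a₁ = x₁, ρ a₂ = x₂} · (m − 1)² ≤ m!` for `a₁ ≠ a₂` (any `x₁, x₂`). [folklore] -/
theorem card_filter_apply₂_mul_le {a₁ a₂ : Fin m} (ha : a₁ ≠ a₂) (x₁ x₂ : Fin m) :
    (Finset.univ.filter fun ρ : Perm (Fin m) => ρ a₁ = x₁ ∧ ρ a₂ = x₂).card * ((m - 1) * (m - 1)) ≤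
      Nat.factorial m := by
  classical
  by_cases hx : x₂ = x₁
  · have hzero : (Finset.univ.filter fun ρ : Perm (Fin m) => ρ a₁ = x₁ ∧ ρ a₂ = x₂).card = 0 := by
      rw [Finset.card_eq_zero, Finset.filter_eq_empty_iff]
      intro ρ _ h
      exact ha (ρ.injective (h.1.trans (hx ▸ h.2).symm))
    rw [hzero, zero_mul]; exact Nat.zero_le _
  · rw [← mul_assoc, card_filter_apply₂_mul ha hx]
    exact card_filter_apply_mul_le a₁ x₁

end PermCount

/-! ## 2. Shared positions per column -/

/-- `r(b, d, a)`: the number of rows `rr` such that position `(rr, a)` carries the same seed cell in blocks `b` and `d`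
(`0` by convention when `b = d`). [this file] -/
def rowShare (b d : Fin 3 → Fin (qOf m)) (a : Fin m) : ℕ := by
  classical
  exact if b = d then 0 else (Finset.univ.filter fun rr : Fin m => cellEmb m b (rr, a) = cellEmb m d (rr, a)).card

/-- `Σ_a r(b, d, a) ≤ 2` (two quadratic curves share `≤ 2` cells). [this file] -/
theorem sum_rowShare_le_two (b d : Fin 3 → Fin (qOf m)) : ∑ a, rowShare b d a ≤ 2 := by
  classical
  by_cases hbd : b = d
  · simp [rowShare, hbd]
  · simp only [rowShare, if_neg hbd]
    have hfib := Finset.card_eq_sum_card_fiberwise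
      (s := (Finset.univ.filter fun x : Fin m × Fin m => cellEmb m b x = cellEmb m d x))
      (t := (Finset.univ : Finset (Fin m))) (f := Prod.snd) (fun _ _ => Finset.mem_univ _)
    have hcol : ∀ a : Fin m,
        ((Finset.univ.filter fun x : Fin m × Fin m => cellEmb m b x = cellEmb m d x).filter fun x => x.2 = a).card =
          (Finset.univ.filter fun rr : Fin m => cellEmb m b (rr, a) = cellEmb m d (rr, a)).card := by
      intro a
      rw [← Finset.card_map ⟨fun rr : Fin m => ((rr, a) : Fin m × Fin m), fun _ _ h => (Prod.mk.inj h).1⟩]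
      congr 1
      ext ⟨rr, a'⟩
      simp only [Finset.mem_filter, Finset.mem_univ, true_and, Finset.mem_map, Function.Embedding.coeFn_mk,
        Prod.mk.injEq]
      constructor
      · rintro ⟨h, rfl⟩; exact ⟨rr, h, rfl, rfl⟩
      · rintro ⟨rr', h, rfl, rfl⟩; exact ⟨h, rfl⟩
    rw [Finset.sum_congr rfl fun a _ => (hcol a).symm, ← hfib]
    exact card_sharedPos_le_two hbd

/-! ## 3. The bad patterns for a fixed host `d` and column-to-block map `f` factor over blocks -/

/-- The admissible patterns of block `b` for `(d, f)`: in every column `a` with `f a = b`, the pattern cell is shared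
with `d` (and `b ≠ d`). [this file] -/
def admissible (d : Fin 3 → Fin (qOf m)) (f : Fin m → (Fin 3 → Fin (qOf m))) (b : Fin 3 → Fin (qOf m)) :
    Finset (Equiv.Perm (Fin m)) := by
  classical
  exact Finset.univ.filter fun ρ => ∀ a, f a = b → (b ≠ d ∧ cellEmb m b (ρ a, a) = cellEmb m d (ρ a, a))

/-- The columns served by block `b`. [this file] -/
def fiber (f : Fin m → (Fin 3 → Fin (qOf m))) (b : Fin 3 → Fin (qOf m)) : Finset (Fin m) := by
  classical
  exact Finset.univ.filter fun a => f a = b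

/-- An admissible pattern sends every served column into the shared rows. [this file] -/
theorem mem_rowFilter_of_mem_admissible {d : Fin 3 → Fin (qOf m)} {f : Fin m → (Fin 3 → Fin (qOf m))}
    {b : Fin 3 → Fin (qOf m)} {ρ : Equiv.Perm (Fin m)} (hρ : ρ ∈ admissible d f b) {a : Fin m} (ha : a ∈ fiber f b) :
    b ≠ d ∧ ρ a ∈ (Finset.univ.filter fun rr : Fin m => cellEmb m b (rr, a) = cellEmb m d (rr, a)) := by
  classical
  have h := (Finset.mem_filter.1 hρ).2 a (Finset.mem_filter.1 ha).2
  exact ⟨h.1, Finset.mem_filter.2 ⟨Finset.mem_univ _, h.2⟩⟩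

/-- **Per-block bound**: `#admissible · (m−1)^k ≤ m! · ∏_{served a} r(b, d, a)` (`k` = number of served columns;
`k ≥ 3` forces `0` on both sides' left, since `Σ_a r ≤ 2`). [this file] -/
theorem card_admissible_mul_le (d : Fin 3 → Fin (qOf m)) (f : Fin m → (Fin 3 → Fin (qOf m)))
    (b : Fin 3 → Fin (qOf m)) :
    (admissible d f b).card * (m - 1) ^ (fiber f b).card ≤ Nat.factorial m * ∏ a ∈ fiber f b, rowShare b d a := by
  classical
  -- if `b` serves no column the bound is `#admissible ≤ m!`
  rcases Nat.eq_zero_or_pos (fiber f b).card with h0 | hpos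
  · rw [Finset.card_eq_zero.1 h0]
    simp only [Finset.card_empty, pow_zero, mul_one, Finset.prod_empty]
    exact (Finset.card_le_univ _).trans (by rw [Fintype.card_perm, Fintype.card_fin])
  -- if `b = d` and `b` serves a column, nothing is admissible
  by_cases hbd : b = d
  · obtain ⟨a, ha⟩ := Finset.card_pos.1 hpos
    have hemp : admissible d f b = ∅ := by
      rw [Finset.eq_empty_iff_forall_notMem]
      intro ρ hρ
      exact (mem_rowFilter_of_mem_admissible hρ ha).1 hbd
    rw [hemp]; simp
  -- if some served column has no shared row, nothing is admissible
  by_cases hz : ∃ a ∈ fiber f b, rowShare b d a = 0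
  · obtain ⟨a, ha, hra⟩ := hz
    have hemp : admissible d f b = ∅ := by
      rw [Finset.eq_empty_iff_forall_notMem]
      intro ρ hρ
      have h := (mem_rowFilter_of_mem_admissible hρ ha).2
      simp only [rowShare, if_neg hbd] at hra
      rw [Finset.card_eq_zero] at hra
      rw [hra] at h
      exact absurd h (Finset.notMem_empty _)
    rw [hemp]; simp
  push Not at hz
  -- hence every served column has `r ≥ 1`, so at most two columns are served
  have hk : (fiber f b).card ≤ 2 := by
    have h1 : (fiber f b).card ≤ ∑ a ∈ fiber f b, rowShare b d a := by
      rw [Finset.card_eq_sum_ones]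
      exact Finset.sum_le_sum fun a ha => Nat.one_le_iff_ne_zero.2 (hz a ha)
    exact h1.trans ((Finset.sum_le_sum_of_subset_of_nonneg (Finset.subset_univ _) fun _ _ _ => Nat.zero_le _).trans
      (sum_rowShare_le_two b d))
  have hrow : ∀ a, rowShare b d a =
      (Finset.univ.filter fun rr : Fin m => cellEmb m b (rr, a) = cellEmb m d (rr, a)).card := by
    intro a; simp only [rowShare, if_neg hbd]
  interval_cases hk' : (fiber f b).card
  · -- one served column `a₁`
    obtain ⟨a₁, ha₁⟩ := Finset.card_eq_one.1 hk'
    rw [ha₁, Finset.prod_singleton, pow_one, hrow a₁]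
    have hsub : admissible d f b ⊆ (Finset.univ.filter fun rr : Fin m => cellEmb m b (rr, a₁) = cellEmb m d (rr, a₁)).biUnion
        fun rr => Finset.univ.filter fun ρ : Equiv.Perm (Fin m) => ρ a₁ = rr := by
      intro ρ hρ
      have h := mem_rowFilter_of_mem_admissible hρ (by rw [ha₁]; exact Finset.mem_singleton_self _)
      exact Finset.mem_biUnion.2 ⟨ρ a₁, h.2, Finset.mem_filter.2 ⟨Finset.mem_univ _, rfl⟩⟩
    calc (admissible d f b).card * (m - 1)
        ≤ (∑ rr ∈ Finset.univ.filter fun rr : Fin m => cellEmb m b (rr, a₁) = cellEmb m d (rr, a₁),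
            (Finset.univ.filter fun ρ : Equiv.Perm (Fin m) => ρ a₁ = rr).card) * (m - 1) :=
          Nat.mul_le_mul_right _ ((Finset.card_le_card hsub).trans Finset.card_biUnion_le)
      _ = ∑ rr ∈ Finset.univ.filter fun rr : Fin m => cellEmb m b (rr, a₁) = cellEmb m d (rr, a₁),
            (Finset.univ.filter fun ρ : Equiv.Perm (Fin m) => ρ a₁ = rr).card * (m - 1) := Finset.sum_mul _ _ _
      _ ≤ ∑ _rr ∈ Finset.univ.filter fun rr : Fin m => cellEmb m b (rr, a₁) = cellEmb m d (rr, a₁), Nat.factorial m :=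
          Finset.sum_le_sum fun rr _ => card_filter_apply_mul_le a₁ rr
      _ = _ := by rw [Finset.sum_const, smul_eq_mul, mul_comm]
  · -- two served columns `a₁ ≠ a₂`
    obtain ⟨a₁, a₂, hne, ha⟩ := Finset.card_eq_two.1 hk'
    rw [ha, Finset.prod_pair hne, hrow a₁, hrow a₂]
    set R₁ := Finset.univ.filter fun rr : Fin m => cellEmb m b (rr, a₁) = cellEmb m d (rr, a₁) with hR₁
    set R₂ := Finset.univ.filter fun rr : Fin m => cellEmb m b (rr, a₂) = cellEmb m d (rr, a₂) with hR₂
    have hsub : admissible d f b ⊆ (R₁ ×ˢ R₂).biUnion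
        fun p => Finset.univ.filter fun ρ : Equiv.Perm (Fin m) => ρ a₁ = p.1 ∧ ρ a₂ = p.2 := by
      intro ρ hρ
      have h1 := mem_rowFilter_of_mem_admissible hρ (by rw [ha]; exact Finset.mem_insert_self _ _)
      have h2 := mem_rowFilter_of_mem_admissible hρ
        (by rw [ha]; exact Finset.mem_insert_of_mem (Finset.mem_singleton_self _))
      exact Finset.mem_biUnion.2 ⟨(ρ a₁, ρ a₂), Finset.mem_product.2 ⟨h1.2, h2.2⟩,
        Finset.mem_filter.2 ⟨Finset.mem_univ _, rfl, rfl⟩⟩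
    have hpow : (m - 1) ^ 2 = (m - 1) * (m - 1) := sq _
    calc (admissible d f b).card * (m - 1) ^ 2
        ≤ (∑ p ∈ R₁ ×ˢ R₂, (Finset.univ.filter fun ρ : Equiv.Perm (Fin m) => ρ a₁ = p.1 ∧ ρ a₂ = p.2).card) *
            ((m - 1) * (m - 1)) := by
          rw [hpow]; exact Nat.mul_le_mul_right _ ((Finset.card_le_card hsub).trans Finset.card_biUnion_le)
      _ = ∑ p ∈ R₁ ×ˢ R₂, (Finset.univ.filter fun ρ : Equiv.Perm (Fin m) => ρ a₁ = p.1 ∧ ρ a₂ = p.2).card *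
            ((m - 1) * (m - 1)) := Finset.sum_mul _ _ _
      _ ≤ ∑ _p ∈ R₁ ×ˢ R₂, Nat.factorial m := Finset.sum_le_sum fun p _ => card_filter_apply₂_mul_le hne p.1 p.2
      _ = _ := by rw [Finset.sum_const, smul_eq_mul, Finset.card_product, mul_comm]

/-! ## 4. Integer AM–GM -/

/-- `(∏_a R_a) · m^m ≤ (Σ_a R_a)^m` for natural numbers. [folklore] -/
theorem prod_mul_pow_le_sum_pow (R : Fin m → ℕ) : (∏ a, R a) * m ^ m ≤ (∑ a, R a) ^ m := by
  rcases Nat.eq_zero_or_pos m with h0 | hm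
  · subst h0; simp
  have hmR : (0 : ℝ) < m := by exact_mod_cast hm
  have h := Real.geom_mean_le_arith_mean (Finset.univ : Finset (Fin m)) (fun _ => (1 : ℝ)) (fun a => (R a : ℝ))
    (fun _ _ => zero_le_one) (by simp [hmR]) (fun _ _ => Nat.cast_nonneg _)
  simp only [Real.rpow_one, one_mul, Finset.sum_const, Finset.card_univ, Fintype.card_fin, nsmul_eq_mul,
    mul_one] at h
  -- `h : (∏ R)^{1/m} ≤ (Σ R) / m`; raise to the `m`-th power
  have hP : (0 : ℝ) ≤ ∏ a, (R a : ℝ) := Finset.prod_nonneg fun _ _ => Nat.cast_nonneg _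
  have hpow := pow_le_pow_left₀ (Real.rpow_nonneg hP _) h m
  rw [Real.rpow_inv_natCast_pow hP hm.ne', div_pow, le_div_iff₀ (pow_pos hmR m)] at hpow
  exact_mod_cast hpow

end Summit.ValiantsHypothesis.ValiantsHypothesis.Theorems.DefinabilityGapPatternCounts
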